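import Summits.Ventures.LatticeQCDFlow.Scaling.ParallelTemperingTaggedReplica
import Summits.Ventures.LatticeQCDFlow.Scaling.SimulatedTemperingLevelKernel

/-!
HONEST FRAMING: exact (Metropolis-corrected) sampling algorithms for lattice gauge theory; figures
of merit are autocorrelation/cost numbers at stated couplings and volumes; no continuum-physics
claim.

# ParallelTemperingSwapKernel — THE REPLICA-EXCHANGE SWAP MOVE (UNIFORMLY CHOSEN ADJACENT PAIR, EXACT
# METROPOLIS TEST) AS A MARKOV KERNEL ON THE TAGGED STATE SPACE `Fin (K+1) × (Fin (K+1) → Ω)`: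
# NEAREST-NEIGHBOUR TAG MOVES, TAG-MOVE PROBABILITY `= ptSwapRatio/K ≤ ptSwapRatio` (lean-2 GEN-14, ours)

Venture-side (OURS).  Cell `lqcd-flow` (pub-lqcd), unit `pub-lqcd-lean-2-g14`, 2026-08-24.  GEN-13's replica-exchange
law (`Scaling/ParallelTemperingDiffusive.pt_level_lagOneAutocorr_ge`) quantifies over ALL Markov kernels on the
tagged space that (i) leave `ptTaggedTarget X μ β K = (K+1)⁻¹·Σ_τ δ_τ ⊗ (⊗_k μ_{β_k})` invariant, (ii) move the tag
by at most one level and (iii) move it with probability at most `ptSwapRatio`; no kernel was constructed.  This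
file CONSTRUCTS the textbook swap move of parallel tempering (Swendsen–Wang 1986 replica Monte Carlo; Geyer 1991;
Hukushima–Nemoto 1996) on the tagged space and proves (ii), (iii); the companion
`Scaling/ParallelTemperingSwapKernelBalance` proves (i) as DETAILED BALANCE.

## The kernel (`X : Ω → ℝ` measurable, levels `β : ℕ → ℝ`, `K` pairs `(j, j+1)`, `j < K`)

From `(τ, x)`: choose `j < K` uniformly; propose exchanging the configurations at levels `j` and `j+1` — the
tagged replica moves with its configuration, `τ ↦ σ_j(τ)` (`σ_j` the transposition of `j`, `j+1`) — and accept with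
the exact Metropolis ratio `r_j(x) = min(1, e^{(β_{j+1}−β_j)(X(x_j) − X(x_{j+1}))})` (`ptPairRatio`):

  `κ(τ, x) = K⁻¹·Σ_{j<K} [ r_j(x)·δ_{(σ_j τ, x∘σ_j)} + (1 − r_j(x))·δ_{(τ, x)} ]`.

## What is defined / proved

* §1 `ptPerm K j` (= `Equiv.swap j (j+1)` on `Fin (K+1)`), `ptConfSwap K j x = x ∘ σ_j`, **`ptSwapMap K j`** (the
  proposal map, a measurable involution: `ptSwapMap_ptSwapMap`); the tag moves by at most one
  (`abs_ptPerm_sub_le_one`) and moves iff `τ ∈ {j, j+1}`, where `ptTagCoef K j τ = 1` (`ptTagCoef_eq_one_of_ne`);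
  **`ptPairRatio_confSwap_mul_exp`** — `r_j(x∘σ_j)·e^{(β_{j+1}−β_j)(X(x_j)−X(x_{j+1}))} = r_j(x)` (the pointwise
  detailed-balance identity of the Metropolis test).
* §2 `ptPairMeasure`, `ptSwapMeasure`, **`ptSwapKernel hXm β K`** (a `Kernel` on the tagged space),
  `ptSwapKernel_apply'`, **`isMarkovKernel_ptSwapKernel`** (`K ≥ 1`), `lintegral_ptSwapKernel`.
* §3 (ii) **`ptSwapKernel_nearestNeighbour`**; (iii) **`ptSwapKernel_real_moves_le`** —
  `κ(z){tag ≠ tag z} ≤ ptSwapRatio X β K z` (literally hypothesis `hmove` of `pt_level_lagOneAutocorr_ge`).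

NOT CLAIMED: half-sweeps of disjoint pairs as one step (also satisfies (i)–(iii); not typed); within-replica
updates (abstract in the companion algorithm file); anything measured.  Literature grade (cell rule): TEXTBOOK
ALGORITHM (Swendsen–Wang, Phys. Rev. Lett. 57 (1986) 2607; Geyer 1991; Hukushima–Nemoto, J. Phys. Soc. Jpn. 65
(1996) 1604), NEW TYPING (Mathlib `Kernel` on a general measurable `Ω`); nothing cited as a fact; no new bib keys.
-/

noncomputable section

open MeasureTheory ProbabilityTheory Set Filter Finset
open scoped ENNReal

namespace Summit.Ventures.LatticeQCDFlow.Scaling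

/-! ## §1 The proposal map: exchange levels `j` and `j+1` -/

section SwapMap

variable {Ω : Type*} {K : ℕ}

/-- The transposition of the adjacent levels `j`, `j+1` of `Fin (K+1)`. [ours] -/
def ptPerm (K : ℕ) (j : Fin K) : Equiv.Perm (Fin (K + 1)) := Equiv.swap (Fin.castSucc j) (Fin.succ j)

/-- Exchanging the configurations at levels `j` and `j+1`: `x ↦ x ∘ σ_j`. [ours] -/
def ptConfSwap (K : ℕ) (j : Fin K) (x : Fin (K + 1) → Ω) : Fin (K + 1) → Ω := fun k => x (ptPerm K j k)

/-- **The swap proposal on the tagged space**: `(τ, x) ↦ (σ_j τ, x ∘ σ_j)` — the tagged replica moves with its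
configuration. [ours] -/
def ptSwapMap (K : ℕ) (j : Fin K) (z : Fin (K + 1) × (Fin (K + 1) → Ω)) : Fin (K + 1) × (Fin (K + 1) → Ω) :=
  (ptPerm K j z.1, ptConfSwap K j z.2)

/-- `σ_j` is an involution. [folklore] -/
@[simp] theorem ptPerm_ptPerm (j : Fin K) (τ : Fin (K + 1)) : ptPerm K j (ptPerm K j τ) = τ :=
  Equiv.swap_apply_self _ _ _

/-- `σ_j(j) = j+1`. [folklore] -/
@[simp] theorem ptPerm_castSucc (j : Fin K) : ptPerm K j (Fin.castSucc j) = Fin.succ j := by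
  simp [ptPerm, Equiv.swap_apply_left]

/-- `σ_j(j+1) = j`. [folklore] -/
@[simp] theorem ptPerm_succ (j : Fin K) : ptPerm K j (Fin.succ j) = Fin.castSucc j := by
  simp [ptPerm, Equiv.swap_apply_right]

/-- The configuration swap is an involution. [folklore] -/
@[simp] theorem ptConfSwap_ptConfSwap (j : Fin K) (x : Fin (K + 1) → Ω) : ptConfSwap K j (ptConfSwap K j x) = x := by
  funext k; simp [ptConfSwap]

/-- After the swap, level `j` holds the old configuration of level `j+1`. [folklore] -/
@[simp] theorem ptConfSwap_apply_castSucc (j : Fin K) (x : Fin (K + 1) → Ω) :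
    ptConfSwap K j x (Fin.castSucc j) = x (Fin.succ j) := by simp [ptConfSwap]

/-- After the swap, level `j+1` holds the old configuration of level `j`. [folklore] -/
@[simp] theorem ptConfSwap_apply_succ (j : Fin K) (x : Fin (K + 1) → Ω) :
    ptConfSwap K j x (Fin.succ j) = x (Fin.castSucc j) := by simp [ptConfSwap]

/-- The swap proposal is an involution. [folklore] -/
@[simp] theorem ptSwapMap_ptSwapMap (j : Fin K) (z : Fin (K + 1) × (Fin (K + 1) → Ω)) :
    ptSwapMap K j (ptSwapMap K j z) = z := by
  simp [ptSwapMap]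

/-- The configuration swap is measurable. [folklore] -/
theorem measurable_ptConfSwap [MeasurableSpace Ω] (j : Fin K) : Measurable (ptConfSwap (Ω := Ω) K j) :=
  measurable_pi_lambda _ fun _ => measurable_pi_apply _

/-- The swap proposal is measurable. [folklore] -/
theorem measurable_ptSwapMap [MeasurableSpace Ω] (j : Fin K) : Measurable (ptSwapMap (Ω := Ω) K j) :=
  ((measurable_of_countable (ptPerm K j)).comp measurable_fst).prodMk ((measurable_ptConfSwap j).comp measurable_snd)

/-- **The tag moves by at most one level**: `|σ_j τ − τ| ≤ 1`. [ours] -/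
theorem abs_ptPerm_sub_le_one (j : Fin K) (τ : Fin (K + 1)) : |(((ptPerm K j τ : Fin (K + 1)) : ℕ) : ℝ) - (τ : ℕ)| ≤ 1 := by
  unfold ptPerm
  rw [Equiv.swap_apply_def]
  split_ifs with h1 h2
  · subst h1; exact abs_natCast_sub_le_one (by simp) (by simp only [Fin.val_succ, Fin.val_castSucc]; omega)
  · subst h2; exact abs_natCast_sub_le_one (by simp only [Fin.val_succ, Fin.val_castSucc]; omega) (by simp)
  · rw [sub_self, abs_zero]; exact zero_le_one

/-- The tag moves iff it sits at one of the two exchanged levels. [folklore] -/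
theorem ptPerm_ne_self_iff (j : Fin K) (τ : Fin (K + 1)) :
    ptPerm K j τ ≠ τ ↔ τ = Fin.castSucc j ∨ τ = Fin.succ j := by
  unfold ptPerm
  rw [Equiv.swap_apply_ne_self_iff]
  exact ⟨fun h => h.2, fun h => ⟨ne_of_lt Fin.castSucc_lt_succ, h⟩⟩

/-- When the tag moves, its incidence coefficient with the pair is `1`. [ours] -/
theorem ptTagCoef_eq_one_of_ne (j : Fin K) (τ : Fin (K + 1)) (h : ptPerm K j τ ≠ τ) : ptTagCoef K j τ = 1 := by
  rw [ptPerm_ne_self_iff] at h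
  have hne : Fin.castSucc j ≠ Fin.succ j := ne_of_lt Fin.castSucc_lt_succ
  unfold ptTagCoef
  rcases h with h | h
  · subst h; rw [if_pos rfl, if_neg hne.symm]; norm_num
  · subst h; rw [if_neg hne, if_pos rfl]; norm_num

variable {X : Ω → ℝ} {β : ℕ → ℝ}

/-- **THE POINTWISE DETAILED-BALANCE IDENTITY OF THE SWAP TEST**: with `a = (β_{j+1}−β_j)(X(x_j) − X(x_{j+1}))`,
`r_j(x ∘ σ_j)·e^{a} = r_j(x)` (`min(1, e^{−a})·e^{a} = min(1, e^{a})`). [ours] -/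
theorem ptPairRatio_confSwap_mul_exp (j : Fin K) (x : Fin (K + 1) → Ω) :
    ptPairRatio X β K j (ptConfSwap K j x) *
        Real.exp ((β ((j : ℕ) + 1) - β (j : ℕ)) * (X (x (Fin.castSucc j)) - X (x (Fin.succ j)))) =
      ptPairRatio X β K j x := by
  unfold ptPairRatio
  rw [ptConfSwap_apply_castSucc, ptConfSwap_apply_succ]
  set a : ℝ := (β ((j : ℕ) + 1) - β (j : ℕ)) * (X (x (Fin.castSucc j)) - X (x (Fin.succ j))) with ha
  have e : (β ((j : ℕ) + 1) - β (j : ℕ)) * (X (x (Fin.succ j)) - X (x (Fin.castSucc j))) = -a := by rw [ha]; ring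
  rw [e, min_mul_of_nonneg _ _ (Real.exp_pos a).le, one_mul, Real.exp_neg, inv_mul_cancel₀ (Real.exp_pos a).ne',
    min_comm]

/-- `0 ≤ 1 − r_j`. [folklore] -/
theorem one_sub_ptPairRatio_nonneg (j : Fin K) (x : Fin (K + 1) → Ω) : 0 ≤ 1 - ptPairRatio X β K j x :=
  sub_nonneg.2 (ptPairRatio_mem j x).2

end SwapMap

/-! ## §2 The kernel -/

section KernelDef

variable {Ω : Type*} [MeasurableSpace Ω] {K : ℕ}

/-- The transition measure of ONE swap attempt at the pair `(j, j+1)`: `r_j·δ_{swap} + (1 − r_j)·δ_{stay}`. [ours] -/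
def ptPairMeasure (X : Ω → ℝ) (β : ℕ → ℝ) (K : ℕ) (j : Fin K) (z : Fin (K + 1) × (Fin (K + 1) → Ω)) :
    Measure (Fin (K + 1) × (Fin (K + 1) → Ω)) :=
  ENNReal.ofReal (ptPairRatio X β K j z.2) • Measure.dirac (ptSwapMap K j z) +
    ENNReal.ofReal (1 - ptPairRatio X β K j z.2) • Measure.dirac z

/-- The transition measure of the swap move: a uniformly chosen adjacent pair, then its swap attempt. [ours] -/
def ptSwapMeasure (X : Ω → ℝ) (β : ℕ → ℝ) (K : ℕ) (z : Fin (K + 1) × (Fin (K + 1) → Ω)) :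
    Measure (Fin (K + 1) × (Fin (K + 1) → Ω)) :=
  ((K : ℕ) : ℝ≥0∞)⁻¹ • ∑ j : Fin K, ptPairMeasure X β K j z

variable {X : Ω → ℝ} {β : ℕ → ℝ}

/-- The swap transition measure on a measurable set. [ours] -/
theorem ptSwapMeasure_apply' (z : Fin (K + 1) × (Fin (K + 1) → Ω)) {s : Set (Fin (K + 1) × (Fin (K + 1) → Ω))}
    (hs : MeasurableSet s) :
    ptSwapMeasure X β K z s = ((K : ℕ) : ℝ≥0∞)⁻¹ * ∑ j : Fin K,
      (ENNReal.ofReal (ptPairRatio X β K j z.2) * s.indicator 1 (ptSwapMap K j z) +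
        ENNReal.ofReal (1 - ptPairRatio X β K j z.2) * s.indicator 1 z) := by
  simp only [ptSwapMeasure, ptPairMeasure, Measure.smul_apply, Measure.coe_finsetSum, Finset.sum_apply,
    Measure.coe_add, Measure.coe_smul, Pi.add_apply, Pi.smul_apply, smul_eq_mul, Measure.dirac_apply' _ hs]

/-- `z ↦ κ(z, ·)` is measurable (for measurable `X`). [ours] -/
theorem measurable_ptSwapMeasure (hXm : Measurable X) : Measurable (ptSwapMeasure X β K) := by
  refine Measure.measurable_of_measurable_coe _ fun s hsm => ?_
  simp only [ptSwapMeasure_apply' _ hsm]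
  refine measurable_const.mul (Finset.measurable_sum _ fun j _ => ?_)
  have hr : Measurable fun z : Fin (K + 1) × (Fin (K + 1) → Ω) => ENNReal.ofReal (ptPairRatio X β K j z.2) :=
    ((measurable_ptPairRatio (β := β) hXm j).comp measurable_snd).ennreal_ofReal
  have hr' : Measurable fun z : Fin (K + 1) × (Fin (K + 1) → Ω) => ENNReal.ofReal (1 - ptPairRatio X β K j z.2) :=
    (measurable_const.sub ((measurable_ptPairRatio (β := β) hXm j).comp measurable_snd)).ennreal_ofReal
  have h1 : Measurable fun z : Fin (K + 1) × (Fin (K + 1) → Ω) =>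
      s.indicator (1 : Fin (K + 1) × (Fin (K + 1) → Ω) → ℝ≥0∞) (ptSwapMap K j z) :=
    measurable_indicator_one_comp (measurable_ptSwapMap j) hsm
  have h2 : Measurable fun z : Fin (K + 1) × (Fin (K + 1) → Ω) =>
      s.indicator (1 : Fin (K + 1) × (Fin (K + 1) → Ω) → ℝ≥0∞) z :=
    measurable_indicator_one_comp measurable_id hsm
  exact (hr.mul h1).add (hr'.mul h2)

/-- **THE REPLICA-EXCHANGE SWAP KERNEL** on the tagged space `Fin (K+1) × (Fin (K+1) → Ω)`: a uniformly chosen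
adjacent pair `(j, j+1)`, exchanged with the exact Metropolis probability `ptPairRatio`; the tag follows its
configuration. [ours] -/
def ptSwapKernel {X : Ω → ℝ} (hXm : Measurable X) (β : ℕ → ℝ) (K : ℕ) :
    Kernel (Fin (K + 1) × (Fin (K + 1) → Ω)) (Fin (K + 1) × (Fin (K + 1) → Ω)) :=
  ⟨ptSwapMeasure X β K, measurable_ptSwapMeasure hXm⟩

/-- The swap kernel at `z` is the swap transition measure. [ours] -/
theorem ptSwapKernel_apply (hXm : Measurable X) (z : Fin (K + 1) × (Fin (K + 1) → Ω)) :
    ptSwapKernel hXm β K z = ptSwapMeasure X β K z := rfl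

/-- The swap kernel on a measurable set. [ours] -/
theorem ptSwapKernel_apply' (hXm : Measurable X) (z : Fin (K + 1) × (Fin (K + 1) → Ω))
    {s : Set (Fin (K + 1) × (Fin (K + 1) → Ω))} (hs : MeasurableSet s) :
    ptSwapKernel hXm β K z s = ((K : ℕ) : ℝ≥0∞)⁻¹ * ∑ j : Fin K,
      (ENNReal.ofReal (ptPairRatio X β K j z.2) * s.indicator 1 (ptSwapMap K j z) +
        ENNReal.ofReal (1 - ptPairRatio X β K j z.2) * s.indicator 1 z) := by
  rw [ptSwapKernel_apply, ptSwapMeasure_apply' _ hs]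

/-- The swap kernel is MARKOV (for `K ≥ 1` pairs). [ours] -/
instance isMarkovKernel_ptSwapKernel (hXm : Measurable X) [NeZero K] : IsMarkovKernel (ptSwapKernel hXm β K) := by
  refine ⟨fun z => ⟨?_⟩⟩
  rw [ptSwapKernel_apply' hXm z MeasurableSet.univ]
  simp only [Set.indicator_univ, Pi.one_apply, mul_one]
  have e : ∀ j : Fin K, ENNReal.ofReal (ptPairRatio X β K j z.2) + ENNReal.ofReal (1 - ptPairRatio X β K j z.2) = 1 :=
    fun j => by
      rw [← ENNReal.ofReal_add (ptPairRatio_mem j z.2).1 (one_sub_ptPairRatio_nonneg j z.2), add_sub_cancel,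
        ENNReal.ofReal_one]
  simp only [e, Finset.sum_const, Finset.card_univ, Fintype.card_fin, nsmul_eq_mul, mul_one]
  exact ENNReal.inv_mul_cancel (by simp [NeZero.ne K]) (ENNReal.natCast_ne_top _)

/-- Integration against the swap kernel: `∫⁻ g dκ(z,·) = K⁻¹·Σ_j (r_j·g(swap_j z) + (1 − r_j)·g(z))`. [ours] -/
theorem lintegral_ptSwapKernel (hXm : Measurable X) {g : Fin (K + 1) × (Fin (K + 1) → Ω) → ℝ≥0∞}
    (hg : Measurable g) (z : Fin (K + 1) × (Fin (K + 1) → Ω)) :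
    ∫⁻ y, g y ∂(ptSwapKernel hXm β K z) = ((K : ℕ) : ℝ≥0∞)⁻¹ * ∑ j : Fin K,
      (ENNReal.ofReal (ptPairRatio X β K j z.2) * g (ptSwapMap K j z) +
        ENNReal.ofReal (1 - ptPairRatio X β K j z.2) * g z) := by
  rw [ptSwapKernel_apply]
  simp only [ptSwapMeasure, ptPairMeasure, lintegral_smul_measure, lintegral_finsetSum_measure,
    lintegral_add_measure, lintegral_dirac' _ hg, smul_eq_mul]

end KernelDef

/-! ## §3 (ii) nearest-neighbour tag moves; (iii) the tag-move probability -/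

section Moves

variable {Ω : Type*} [MeasurableSpace Ω] {X : Ω → ℝ} {β : ℕ → ℝ} {K : ℕ}

/-- **(ii) THE SWAP KERNEL MOVES THE TAG BY AT MOST ONE LEVEL.** [ours] -/
theorem ptSwapKernel_nearestNeighbour (hXm : Measurable X) (z : Fin (K + 1) × (Fin (K + 1) → Ω)) :
    ∀ᵐ y ∂(ptSwapKernel hXm β K z), |(((y.1 : Fin (K + 1)) : ℕ) : ℝ) - ((z.1 : Fin (K + 1)) : ℕ)| ≤ 1 := by
  rw [ae_iff]
  set S : Set (Fin (K + 1) × (Fin (K + 1) → Ω)) :=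
    {y | ¬ |(((y.1 : Fin (K + 1)) : ℕ) : ℝ) - ((z.1 : Fin (K + 1)) : ℕ)| ≤ 1} with hS_def
  have e : S = (fun y : Fin (K + 1) × (Fin (K + 1) → Ω) => ((y.1 : Fin (K + 1)) : ℕ)) ⁻¹'
      {n : ℕ | ¬ |((n : ℕ) : ℝ) - ((z.1 : Fin (K + 1)) : ℕ)| ≤ 1} := by
    ext y; simp [hS_def]
  have hS : MeasurableSet S := by rw [e]; exact measurable_ptLevel MeasurableSet.of_discrete
  rw [ptSwapKernel_apply' hXm z hS]
  have h1 : ∀ j : Fin K, ptSwapMap K j z ∉ S := fun j => by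
    rw [hS_def, Set.mem_setOf_eq, not_not]; exact abs_ptPerm_sub_le_one j z.1
  have h2 : z ∉ S := by
    rw [hS_def, Set.mem_setOf_eq, not_not, sub_self, abs_zero]; exact zero_le_one
  simp [Set.indicator_of_notMem (h1 _), Set.indicator_of_notMem h2]

/-- **(iii) THE PROBABILITY THAT THE SWAP KERNEL MOVES THE TAG IS AT MOST `ptSwapRatio`** (it equals
`ptSwapRatio/K`): hypothesis `hmove` of GEN-13's `pt_level_lagOneAutocorr_ge`. [ours] -/
theorem ptSwapKernel_real_moves_le (hXm : Measurable X) (hK : 1 ≤ K) (z : Fin (K + 1) × (Fin (K + 1) → Ω)) :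
    (ptSwapKernel hXm β K z).real {y | ((y.1 : Fin (K + 1)) : ℕ) ≠ ((z.1 : Fin (K + 1)) : ℕ)} ≤
      ptSwapRatio X β K z := by
  set S : Set (Fin (K + 1) × (Fin (K + 1) → Ω)) := {y | ((y.1 : Fin (K + 1)) : ℕ) ≠ ((z.1 : Fin (K + 1)) : ℕ)}
    with hS_def
  have e : S = (fun y : Fin (K + 1) × (Fin (K + 1) → Ω) => ((y.1 : Fin (K + 1)) : ℕ)) ⁻¹'
      {n : ℕ | n ≠ ((z.1 : Fin (K + 1)) : ℕ)} := by
    ext y; simp [hS_def]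
  have hS : MeasurableSet S := by rw [e]; exact measurable_ptLevel MeasurableSet.of_discrete
  refine ENNReal.toReal_le_of_le_ofReal (ptSwapRatio_nonneg z) ?_
  rw [ptSwapKernel_apply' hXm z hS]
  have hz : z ∉ S := by simp [hS_def]
  simp only [Set.indicator_of_notMem hz, mul_zero, add_zero]
  -- each swap indicator is dominated by the tag's incidence coefficient
  have hterm : ∀ j : Fin K, ENNReal.ofReal (ptPairRatio X β K j z.2) * S.indicator 1 (ptSwapMap K j z) ≤
      ENNReal.ofReal (ptTagCoef K j z.1 * ptPairRatio X β K j z.2) := by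
    intro j
    by_cases hmem : ptSwapMap K j z ∈ S
    · have hne : ptPerm K j z.1 ≠ z.1 := by
        intro h
        apply hmem
        show ((ptPerm K j z.1 : Fin (K + 1)) : ℕ) = ((z.1 : Fin (K + 1)) : ℕ)
        rw [h]
      rw [Set.indicator_of_mem hmem, Pi.one_apply, mul_one, ptTagCoef_eq_one_of_ne j z.1 hne, one_mul]
    · rw [Set.indicator_of_notMem hmem, mul_zero]; exact zero_le
  have hKinv : ((K : ℕ) : ℝ≥0∞)⁻¹ ≤ 1 := ENNReal.inv_le_one.2 (by exact_mod_cast hK)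
  calc ((K : ℕ) : ℝ≥0∞)⁻¹ * ∑ j : Fin K, ENNReal.ofReal (ptPairRatio X β K j z.2) * S.indicator 1 (ptSwapMap K j z)
      ≤ 1 * ∑ j : Fin K, ENNReal.ofReal (ptTagCoef K j z.1 * ptPairRatio X β K j z.2) :=
        mul_le_mul' hKinv (Finset.sum_le_sum fun j _ => hterm j)
    _ = ENNReal.ofReal (ptSwapRatio X β K z) := by
        rw [one_mul, ptSwapRatio, ENNReal.ofReal_sum_of_nonneg fun j _ =>
          mul_nonneg (ptTagCoef_mem j z.1).1 (ptPairRatio_mem j z.2).1]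

end Moves

end Summit.Ventures.LatticeQCDFlow.Scaling

end
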